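import Summits.QuantumFields.YangMills.Theorems.UnitScaleTiltHistoryTailMechanismA
import Summits.QuantumFields.YangMills.Theorems.AlphaInputsT3AC
import Literature.MathematicalPhysics.QuantumFieldTheory.Balaban1983to89.T3AlphaInputsACSchemas

/-!
# Route `UnitScaleTilt` — crux K2 `HistoryTail` (stmt-QuantumFields-18916): THE CONSUMER SIDE OF THE LANDED (α) INTERFACE
# `Balaban1983to89.T3AlphaInputsAC{,Schemas}` — Mechanism A re-cut to the deliverable A.E. envelopes, the package-to-sandwich adapter, and the
# v5 COMPOSITION `stub_laneInputsT3 → stub_alphaOfLane(+Extra) → stub_decoupling(Extra) ⇒ stub_perPlaquetteHighRaw` (support file)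

Fleet lead `ym-ust-18916-p1` (gen 2), 2026-08-26; owner ruling g15-№2 (iv) (ym3-torus STATUS 17:19:37Z): the v5 cut of crux 18916 replaces the
active XXL stub `stub_perPlaquetteHighRaw` (birth v4, 2dd95f606719a12c) by THREE registered stubs — `stub_laneInputsT3` (NODE O's by-name socket:
`Theorems.AlphaInputsT3AC L`, p453618), `stub_alphaOfLaneFull` (alpha-1's LINE 2 feed: from the (α) rows of one constants record, a datum
`D : AlphaDataT3 F γ` satisfying the PACKAGE `T3AlphaInputsACSchemas.AlphaInputsT3AC D b₀ p₀ ε₀ C68` plus the S5-readiness clauses), and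
`stub_decoupling` (the located-unprinted core S5: for every such datum, the NUMERATOR BOUND `∫_{E′(p)} up_D ≤ C·β^A·e^{−¼p² + κx^{2+3r₀}}·∫ low_D`) —
composed through the landed assembly `HistoryTailMechanismA.gibbsK_real_largePlaquette_le_of_sandwich` (p446734).  Two things stand between that
assembly and the interface as landed, and THIS FILE supplies both:

* §1 **THE A.E. RE-CUT** (pub-balaban3d finding F-α1-2, interface §7 v1.2): `resDensity` is the raw iterated Radon–Nikodym transport, a CHOSEN
  version, so (41′)/(47′) are deliverable only `dV`-almost everywhere (`Ineq41AE`/`Ineq47AE`).  `setIntegral_div_integral_le_ae` and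
  `gibbsK_real_largePlaquette_le_of_sandwich_ae` are p446734's two theorems with `∀ W` weakened to `∀ᵐ W` (the consumers integrate:
  `setIntegral_mono_ae`/`integral_mono_ae`; nothing else changes).
* §2 **THE PACKAGE ADAPTER**: `gibbsK_real_largePlaquette_le_of_alphaInputs` — for a datum with `AlphaInputsT3AC D b₀ p₀ ε₀ C68`, a numerator
  bound `∫_{θ ≤ |W(∂p)−1|} up_D ≤ B·∫ low_D` at `(K, j, p)` gives `Gibbs_K{θ ≤ |Ū^j(∂p) − 1|} ≤ e^{2Rm_j}·B` (B1/B2 = `ineq41AE/ineq47AE`, B3 =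
  `low_nonneg` from `ChiRange`, B4/B5 = `EnvelopeRegular`); and `…_uniform_of_alphaInputs` with contract B6 (`e^{2Rm_j} ≤ CRm` cut-off-uniformly,
  from `SizesR` through `exp_two_Rm_le`): `≤ CRm·B` for `0 ≤ B`.
* §3 **THE v5 COMPOSITION** `perPlaquetteHighRaw_of_alpha_decoupling`: from (L) the lane's input package at every admissible block size, (A) the
  feed «constants record ⇒ below thresholds `ε₁(L, 𝔠)`, `γ₁(L, 𝔠, ε₀, b₀, p₀)` every family carries SOME datum with the package and a side
  condition `Extra D b₀ p₀ ε₀`», and (D) the decoupling «for SOME collar exponents `(r₀, κ)`, profile `(b₀, p₀)` with `p₀ > 1 + 3r₀/2` and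
  threshold `γ₁ ≤ 1`, EVERY datum with the package and `Extra` obeys the numerator bound above heights `j₀(F, γ, D)` with constants `C(F, γ, D) ≥ 0`,
  `A`», the registered text of `stub_perPlaquetteHighRaw` follows VERBATIM (`C := CRm·C`, same `A`).  `Extra` is ABSTRACT (the pattern of
  `LogComparisonSocket.logComparisonRegPr_of_exists_data`, p452026): the skeleton instantiates it with whatever S5-readiness clauses the owner
  registers (`∃ W C68 Cχ B₃, AlphaInputsT3ACFull D W …` today, plus the weight/`Zterm` size clauses the decoupling needs — lead finding F-g2-1),
  so the composition is registration-invariant.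

WHAT THIS IS NOT: no (α) construction, no decoupling, no new interface (no `def`); every hypothesis is a binder.  Nothing here depends on the
block-size floor of ruling g15-№2 (iii) (all statements are `L`-parametric below the binder `Odd L → 1 < L`).

References: T. Bałaban, CMP 102 (1985) 255–275 [Balaban1985UV3] ((41) p.266, (47) p.267, (70)–(71) p.273); C. King, CMP 102 (1986) 649–677
[King1986] (Thm 4.1); T. Bałaban, CMP 122 (1989) 355–392 [Balaban1989LargeFieldII] (Thm 1 p.357).
-/

noncomputable section

open MeasureTheory
open Literature.MathematicalPhysics.QuantumFieldTheory.Balaban1983to89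
open Literature.MathematicalPhysics.QuantumFieldTheory.Balaban1983to89.T3ContinuumYM3Torus
open Literature.MathematicalPhysics.QuantumFieldTheory.Balaban1983to89.T3UnitScaleTilt
open Literature.MathematicalPhysics.QuantumFieldTheory.Balaban1983to89.T3UnitLawDensityEML
open Literature.MathematicalPhysics.QuantumFieldTheory.Balaban1983to89.T3RestrictedUnitDensity
open Literature.MathematicalPhysics.QuantumFieldTheory.Balaban1983to89.Missing (boltzmann partitionFn measurable_plaqHol)
open Literature.MathematicalPhysics.QuantumFieldTheory.Balaban1983to89.T3AlphaInputsAC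
open Literature.MathematicalPhysics.QuantumFieldTheory.Balaban1983to89.T3AlphaInputsACSchemas
open Summit.QuantumFields.YangMills.Theorems.HistoryTailDensityTransfer (gibbsK_real_largePlaquette_eq)
open Summit.QuantumFields.YangMills.Theorems.HistoryTailSandwich (partitionFn_eq_integral_resDensity)
open Summit.QuantumFields.YangMills.Theorems.HistoryTailMechanismA (integral_mul_indicator_one_eq_setIntegral)

namespace Summit.QuantumFields.YangMills.Theorems.HistoryTailAlphaConsumer

/-! ## §1 Mechanism A re-cut to the a.e. envelopes (41′)/(47′) -/

/-- **THE RATIO BOOKKEEPING, A.E. FORM** (p446734's `setIntegral_div_integral_le` with the sandwich hypotheses `dμ`-almost everywhere): if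
`ρ ≤ e^{−E+Rm}·up` and `e^{−E−Rm}·low ≤ ρ` a.e., `low ≥ 0`, `∫ low > 0`, and `∫_S up ≤ B·∫ low`, then `(∫_S ρ)/(∫ ρ) ≤ e^{2Rm}·B`.
[cite: Balaban1985UV3, (41) p.266 and (47) p.267] -/
theorem setIntegral_div_integral_le_ae {X : Type*} [MeasurableSpace X] (μ : Measure X) (S : Set X) (ρ up low : X → ℝ)
    (E Rm B : ℝ)
    (h41 : ∀ᵐ x ∂μ, ρ x ≤ Real.exp (-E + Rm) * up x) (h47 : ∀ᵐ x ∂μ, Real.exp (-E - Rm) * low x ≤ ρ x)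
    (hlow0 : ∀ x, 0 ≤ low x)
    (hρ : Integrable ρ μ) (hup : IntegrableOn up S μ) (hlow : Integrable low μ)
    (hpos : 0 < ∫ x, low x ∂μ) (hnum : ∫ x in S, up x ∂μ ≤ B * ∫ x, low x ∂μ) :
    (∫ x in S, ρ x ∂μ) / (∫ x, ρ x ∂μ) ≤ Real.exp (2 * Rm) * B := by
  set Lo : ℝ := ∫ x, low x ∂μ with hLo
  set N : ℝ := ∫ x in S, ρ x ∂μ with hN
  set D : ℝ := ∫ x, ρ x ∂μ with hD
  have hρ0 : ∀ᵐ x ∂μ, 0 ≤ ρ x := by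
    filter_upwards [h47] with x hx
    exact (mul_nonneg (Real.exp_nonneg _) (hlow0 x)).trans hx
  have hNle : N ≤ Real.exp (-E + Rm) * (B * Lo) := by
    calc N ≤ ∫ x in S, Real.exp (-E + Rm) * up x ∂μ :=
          setIntegral_mono_ae hρ.integrableOn (hup.const_mul _) h41
      _ = Real.exp (-E + Rm) * ∫ x in S, up x ∂μ := integral_const_mul _ _
      _ ≤ Real.exp (-E + Rm) * (B * Lo) := mul_le_mul_of_nonneg_left hnum (Real.exp_nonneg _)
  have hDge : Real.exp (-E - Rm) * Lo ≤ D := by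
    rw [hLo, hD, ← integral_const_mul]
    exact integral_mono_ae (hlow.const_mul _) hρ h47
  have hN0 : 0 ≤ N := setIntegral_nonneg_of_ae hρ0
  have hD' : 0 < Real.exp (-E - Rm) * Lo := mul_pos (Real.exp_pos _) hpos
  calc N / D ≤ N / (Real.exp (-E - Rm) * Lo) := div_le_div_of_nonneg_left hN0 hD' hDge
    _ ≤ Real.exp (-E + Rm) * (B * Lo) / (Real.exp (-E - Rm) * Lo) := div_le_div_of_nonneg_right hNle hD'.le
    _ = Real.exp (2 * Rm) * B := by
        have hsplit : Real.exp (-E + Rm) = Real.exp (2 * Rm) * Real.exp (-E - Rm) := by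
          rw [← Real.exp_add]; ring_nf
        rw [hsplit]
        field_simp

variable (F : T3Family) {γ : ℝ}

/-- **MECHANISM A, ASSEMBLED, A.E. FORM** (p446734's `gibbsK_real_largePlaquette_le_of_sandwich` for the deliverable envelopes): for the route's
`j`-fold renormalised density `ρ_j = resDensity F γ K univ j` (`j ≤ K`, `0 ≤ γ`), an a.e. sandwich `ρ_j ≤ e^{−E+Rm}·up`, `e^{−E−Rm}·low ≤ ρ_j`
(`low ≥ 0`, `∫ low > 0`) and a numerator bound `∫_{θ ≤ |W(∂p)−1|} up ≤ B·∫ low` give `Gibbs_K{θ ≤ |Ū^{j}(∂p) − 1|} ≤ e^{2Rm}·B`.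
[cite: Balaban1985UV3, (41) p.266, (47) p.267 and (71) p.273] -/
theorem gibbsK_real_largePlaquette_le_of_sandwich_ae (hγ : 0 ≤ γ) {K j : ℕ} (hjK : j ≤ K) (p : Plaq (F.P K) j) (θ : ℝ)
    (up low : GaugeField (F.P K) j (Matrix.specialUnitaryGroup (Fin 2) ℂ) → ℝ) (E Rm B : ℝ)
    (h41 : ∀ᵐ W ∂fieldMeasure (F.P K) j (Matrix.specialUnitaryGroup (Fin 2) ℂ),
      resDensity F γ K Set.univ j W ≤ Real.exp (-E + Rm) * up W)
    (h47 : ∀ᵐ W ∂fieldMeasure (F.P K) j (Matrix.specialUnitaryGroup (Fin 2) ℂ),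
      Real.exp (-E - Rm) * low W ≤ resDensity F γ K Set.univ j W)
    (hlow0 : ∀ W, 0 ≤ low W)
    (hup : IntegrableOn up {W | θ ≤ GaugeGroup.dist1 (GaugeField.plaqHol W p)}
      (fieldMeasure (F.P K) j (Matrix.specialUnitaryGroup (Fin 2) ℂ)))
    (hlow : Integrable low (fieldMeasure (F.P K) j (Matrix.specialUnitaryGroup (Fin 2) ℂ)))
    (hpos : 0 < ∫ W, low W ∂fieldMeasure (F.P K) j (Matrix.specialUnitaryGroup (Fin 2) ℂ))
    (hnum : ∫ W in {W | θ ≤ GaugeGroup.dist1 (GaugeField.plaqHol W p)}, up W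
        ∂fieldMeasure (F.P K) j (Matrix.specialUnitaryGroup (Fin 2) ℂ) ≤
      B * ∫ W, low W ∂fieldMeasure (F.P K) j (Matrix.specialUnitaryGroup (Fin 2) ℂ)) :
    (gibbsK F ℰp γ K).real
        {U | θ ≤ GaugeGroup.dist1 (GaugeField.plaqHol (Averaging.iter (fun _ => BlockAveraging.blockAvg ℰp) j U) p)} ≤
      Real.exp (2 * Rm) * B := by
  have hj : j ≤ F.m + K := hjK.trans (Nat.le_add_left K F.m)
  have hE : MeasurableSet {W : GaugeField (F.P K) j (Matrix.specialUnitaryGroup (Fin 2) ℂ) |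
      θ ≤ GaugeGroup.dist1 (GaugeField.plaqHol W p)} :=
    measurableSet_le measurable_const (RegularGaugeGroup.measurable_dist1.comp (measurable_plaqHol p))
  rw [gibbsK_real_largePlaquette_eq F hγ hj p θ, partitionFn_eq_integral_resDensity F hγ hj,
    integral_mul_indicator_one_eq_setIntegral _ hE]
  exact setIntegral_div_integral_le_ae _ _ _ up low E Rm B h41 h47 hlow0
    (integrable_resDensity F K MeasurableSet.univ hγ hj) hup hlow hpos hnum

/-! ## §2 The package adapter: `AlphaInputsT3AC D …` ⇒ the sandwich hypotheses of Mechanism A (contract B1–B6) -/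

variable {F}

/-- **THE PACKAGE FEEDS MECHANISM A**: for a datum `D` with `AlphaInputsT3AC D b₀ p₀ ε₀ C68` (B1/B2 the a.e. envelopes, B3 `0 ≤ low` from
`ChiRange`, B4/B5 `EnvelopeRegular`), a numerator bound `∫_{θ ≤ |W(∂p)−1|} up_D ≤ B·∫ low_D` at `(K, j, p)`, `j ≤ K`, gives the per-plaquette
Gibbs tail `Gibbs_K{θ ≤ |Ū^{j}(∂p) − 1|} ≤ e^{2Rm^{(K)}_j}·B`. [cite: Balaban1985UV3, (41) p.266 and (47) p.267] -/
theorem gibbsK_real_largePlaquette_le_of_alphaInputs (hγ : 0 ≤ γ) {D : AlphaDataT3 F γ} {b₀ p₀ ε₀ C68 : ℝ}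
    (hD : T3AlphaInputsACSchemas.AlphaInputsT3AC D b₀ p₀ ε₀ C68) {K j : ℕ} (hjK : j ≤ K) (p : Plaq (F.P K) j) (θ B : ℝ)
    (hnum : ∫ W in {W | θ ≤ GaugeGroup.dist1 (GaugeField.plaqHol W p)}, D.up K j W
        ∂fieldMeasure (F.P K) j (Matrix.specialUnitaryGroup (Fin 2) ℂ) ≤
      B * ∫ W, D.low K j W ∂fieldMeasure (F.P K) j (Matrix.specialUnitaryGroup (Fin 2) ℂ)) :
    (gibbsK F ℰp γ K).real
        {U | θ ≤ GaugeGroup.dist1 (GaugeField.plaqHol (Averaging.iter (fun _ => BlockAveraging.blockAvg ℰp) j U) p)} ≤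
      Real.exp (2 * D.Rm K j) * B :=
  have hreg := hD.envelopeRegular hjK
  gibbsK_real_largePlaquette_le_of_sandwich_ae F hγ hjK p θ (D.up K j) (D.low K j) (D.Ecst K j) (D.Rm K j) B
    (hD.ineq41AE hjK) (hD.ineq47AE hjK) (hD.low_nonneg K j) (integrableOn_up hreg _) hreg.1 hreg.2.2 hnum

/-- **THE SAME WITH CONTRACT B6** (the factors `e^{2Rm_j}` bounded uniformly in the cut-off, from `SizesR` through `exp_two_Rm_le`): one constant
`CRm ≥ 0`, depending on the datum only, such that every numerator bound with `0 ≤ B` gives `Gibbs_K{θ ≤ |Ū^{j}(∂p) − 1|} ≤ CRm·B`.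
[cite: Balaban1985UV3, (41) p.266 and (47) p.267] -/
theorem gibbsK_real_largePlaquette_le_uniform_of_alphaInputs (hγ : 0 ≤ γ) {D : AlphaDataT3 F γ} {b₀ p₀ ε₀ C68 : ℝ}
    (hD : T3AlphaInputsACSchemas.AlphaInputsT3AC D b₀ p₀ ε₀ C68) :
    ∃ CRm : ℝ, 0 ≤ CRm ∧ ∀ (K j : ℕ), j ≤ K → ∀ (p : Plaq (F.P K) j) (θ B : ℝ), 0 ≤ B →
      (∫ W in {W | θ ≤ GaugeGroup.dist1 (GaugeField.plaqHol W p)}, D.up K j W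
          ∂fieldMeasure (F.P K) j (Matrix.specialUnitaryGroup (Fin 2) ℂ) ≤
        B * ∫ W, D.low K j W ∂fieldMeasure (F.P K) j (Matrix.specialUnitaryGroup (Fin 2) ℂ)) →
      (gibbsK F ℰp γ K).real
          {U | θ ≤ GaugeGroup.dist1 (GaugeField.plaqHol (Averaging.iter (fun _ => BlockAveraging.blockAvg ℰp) j U) p)} ≤
        CRm * B := by
  obtain ⟨CRm, hCRm⟩ := hD.exp_two_Rm_le
  have h0 : 0 ≤ CRm := (Real.exp_pos _).le.trans (hCRm 0 0 le_rfl)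
  refine ⟨CRm, h0, fun K j hjK p θ B hB hnum => ?_⟩
  exact (gibbsK_real_largePlaquette_le_of_alphaInputs hγ hD hjK p θ B hnum).trans
    (mul_le_mul_of_nonneg_right (hCRm K j hjK) hB)

/-! ## §3 The v5 composition: lane inputs → (α) feed with a side condition `Extra` → decoupling for data with `Extra` ⇒ `stub_perPlaquetteHighRaw` -/

/-- **`stub_perPlaquetteHighRaw ⇐ stub_laneInputsT3 ∧ stub_alphaOfLane(Extra) ∧ stub_decoupling(Extra)`** — THE v5 COMPOSITION OF CRUX 18916
(owner ruling g15-№2 (iv)), for an ABSTRACT side condition `Extra D b₀ p₀ ε₀` on the delivered datum (instantiated by the skeleton with the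
S5-readiness clauses of record, e.g. `∃ W C68 Cχ B₃, AlphaInputsT3ACFull D W b₀ p₀ ε₀ C68 Cχ B₃ ∧ …`).  Threading: `𝔠` from (L); `(r₀, κ, b₀, p₀, γ₁ᴰ)`
from (D); `ε₀ := ε₁(L, 𝔠)` and `γ₁ᴬ(b₀, p₀)` from (A); `γ₁ := min γ₁ᴬ γ₁ᴰ ≤ 1`; per family the datum from (A) (fed by (L) at `F`), the heights
`j₀` and constants `(C, A)` from (D), and `CRm` from §2 — conclusion = the registered text VERBATIM with `C := CRm·C`.
[cite: Balaban1985UV3, (41) p.266, (47) p.267 and (71) p.273] -/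
theorem perPlaquetteHighRaw_of_alpha_decoupling
    (Extra : ∀ {F : T3Family} {γ : ℝ}, AlphaDataT3 F γ → ℝ → ℝ → ℝ → Prop)
    (hLane : ∀ (L : ℕ), Odd L → 1 < L → Summit.QuantumFields.YangMills.Theorems.AlphaInputsT3AC L)
    (hA : ∀ (L : ℕ), Odd L → 1 < L →
      ∀ 𝔠 : Summit.QuantumFields.Balaban3D.Proofs.Primitives.AlphaConsts L
          (Summit.QuantumFields.Balaban3D.Carriers.suGroupModel 2).N,
        ∃ ε₁ : ℝ, 0 < ε₁ ∧ ∀ (ε₀ : ℝ), 0 < ε₀ → ε₀ ≤ ε₁ → ∀ (b₀ p₀ : ℝ), 0 < b₀ → 2 < p₀ →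
          ∃ γ₁ : ℝ, 0 < γ₁ ∧ ∀ (F : T3Family) (γ : ℝ) (hF : F.L = L), 0 < γ → γ ≤ γ₁ →
            Summit.QuantumFields.YangMills.Theorems.AlphaInputsT3AC.Of F (hF ▸ 𝔠) →
              ∃ (D : AlphaDataT3 F γ) (C68 : ℝ), T3AlphaInputsACSchemas.AlphaInputsT3AC D b₀ p₀ ε₀ C68 ∧ Extra D b₀ p₀ ε₀)
    (hDec : ∀ (L : ℕ), Odd L → 1 < L →
      ∃ r₀ κ b₀ p₀ γ₁ : ℝ, 0 ≤ r₀ ∧ 0 ≤ κ ∧ 0 < b₀ ∧ 2 < p₀ ∧ 1 + 3 * r₀ / 2 < p₀ ∧ 0 < γ₁ ∧ γ₁ ≤ 1 ∧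
        ∀ (F : T3Family) (γ : ℝ), F.L = L → 0 < γ → γ ≤ γ₁ →
          ∀ (D : AlphaDataT3 F γ) (ε₀ C68 : ℝ), T3AlphaInputsACSchemas.AlphaInputsT3AC D b₀ p₀ ε₀ C68 → Extra D b₀ p₀ ε₀ →
            ∃ (j₀ : ℕ) (C : ℝ) (A : ℕ), 0 ≤ C ∧
              ∀ (K j : ℕ), j₀ < j → j ≤ K → ∀ p : Plaq (F.P K) j,
                ∫ W in {W | θBal F.L γ b₀ p₀ (K - j) ≤ GaugeGroup.dist1 (GaugeField.plaqHol W p)}, D.up K j W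
                    ∂fieldMeasure (F.P K) j (Matrix.specialUnitaryGroup (Fin 2) ℂ) ≤
                  C * (F.scheme ℰp γ).β (K - j) ^ A *
                    Real.exp (-(B10.pFun b₀ p₀ (Real.sqrt (γ * ((F.L : ℝ)⁻¹) ^ (K - j))) ^ 2 / 4) +
                      κ * (1 + Real.log (Real.sqrt (γ * ((F.L : ℝ)⁻¹) ^ (K - j)))⁻¹) ^ (2 + 3 * r₀)) *
                    ∫ W, D.low K j W ∂fieldMeasure (F.P K) j (Matrix.specialUnitaryGroup (Fin 2) ℂ)) :
    ∀ (L : ℕ), Odd L → 1 < L →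
      ∃ r₀ κ b₀ p₀ γ₁ : ℝ, 0 ≤ r₀ ∧ 0 ≤ κ ∧ 0 < b₀ ∧ 2 < p₀ ∧ 1 + 3 * r₀ / 2 < p₀ ∧ 0 < γ₁ ∧ γ₁ ≤ 1 ∧
        ∀ (F : T3Family) (γ : ℝ), F.L = L → 0 < γ → γ ≤ γ₁ →
          ∃ (j₀ : ℕ) (C : ℝ) (A : ℕ), 0 ≤ C ∧
            ∀ (K j : ℕ), j₀ < j → j ≤ K → ∀ p : Plaq (F.P K) j,
              (gibbsK F ℰp γ K).real
                  {U | θBal F.L γ b₀ p₀ (K - j) ≤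
                    GaugeGroup.dist1 (GaugeField.plaqHol
                      (Averaging.iter (fun _ => BlockAveraging.blockAvg ℰp) j U) p)} ≤
                C * (F.scheme ℰp γ).β (K - j) ^ A *
                  Real.exp (-(B10.pFun b₀ p₀ (Real.sqrt (γ * ((F.L : ℝ)⁻¹) ^ (K - j))) ^ 2 / 4) +
                    κ * (1 + Real.log (Real.sqrt (γ * ((F.L : ℝ)⁻¹) ^ (K - j)))⁻¹) ^ (2 + 3 * r₀)) := by
  intro L hLo hL
  obtain ⟨𝔠, h𝔠⟩ := hLane L hLo hL
  obtain ⟨r₀, κ, b₀, p₀, γD, hr₀, hκ, hb, hp2, hp, hγD, hγD1, hdec⟩ := hDec L hLo hL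
  obtain ⟨ε₁, hε₁, hε⟩ := hA L hLo hL 𝔠
  obtain ⟨γA, hγA, halpha⟩ := hε ε₁ hε₁ le_rfl b₀ p₀ hb hp2
  refine ⟨r₀, κ, b₀, p₀, min γA γD, hr₀, hκ, hb, hp2, hp, lt_min hγA hγD, (min_le_right _ _).trans hγD1,
    fun F γ hFL hγ hle => ?_⟩
  obtain ⟨D, C68, hD, hX⟩ := halpha F γ hFL hγ (hle.trans (min_le_left _ _)) (h𝔠 F hFL)
  obtain ⟨j₀, C, A, hC, hnum⟩ := hdec F γ hFL hγ (hle.trans (min_le_right _ _)) D ε₁ C68 hD hX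
  obtain ⟨CRm, hCRm, htail⟩ := gibbsK_real_largePlaquette_le_uniform_of_alphaInputs hγ.le hD
  refine ⟨j₀, CRm * C, A, mul_nonneg hCRm hC, fun K j hj hjK p => ?_⟩
  have hB : 0 ≤ C * (F.scheme ℰp γ).β (K - j) ^ A *
      Real.exp (-(B10.pFun b₀ p₀ (Real.sqrt (γ * ((F.L : ℝ)⁻¹) ^ (K - j))) ^ 2 / 4) +
        κ * (1 + Real.log (Real.sqrt (γ * ((F.L : ℝ)⁻¹) ^ (K - j)))⁻¹) ^ (2 + 3 * r₀)) :=
    mul_nonneg (mul_nonneg hC (pow_nonneg (F.scheme_β_nonneg ℰp hγ.le (K - j)) A)) (Real.exp_nonneg _)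
  have h := htail K j hjK p (θBal F.L γ b₀ p₀ (K - j)) _ hB (hnum K j hj hjK p)
  calc (gibbsK F ℰp γ K).real
          {U | θBal F.L γ b₀ p₀ (K - j) ≤
            GaugeGroup.dist1 (GaugeField.plaqHol (Averaging.iter (fun _ => BlockAveraging.blockAvg ℰp) j U) p)}
        ≤ CRm * (C * (F.scheme ℰp γ).β (K - j) ^ A *
            Real.exp (-(B10.pFun b₀ p₀ (Real.sqrt (γ * ((F.L : ℝ)⁻¹) ^ (K - j))) ^ 2 / 4) +
              κ * (1 + Real.log (Real.sqrt (γ * ((F.L : ℝ)⁻¹) ^ (K - j)))⁻¹) ^ (2 + 3 * r₀))) := h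
    _ = CRm * C * (F.scheme ℰp γ).β (K - j) ^ A *
            Real.exp (-(B10.pFun b₀ p₀ (Real.sqrt (γ * ((F.L : ℝ)⁻¹) ^ (K - j))) ^ 2 / 4) +
              κ * (1 + Real.log (Real.sqrt (γ * ((F.L : ℝ)⁻¹) ^ (K - j)))⁻¹) ^ (2 + 3 * r₀)) := by ring

end Summit.QuantumFields.YangMills.Theorems.HistoryTailAlphaConsumer

end
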